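import Literature.AlgebraicGeometry.HodgeTheory.HodgeLociDichotomyOfWeightTwoFrames
import Literature.AlgebraicGeometry.HodgeTheory.HodgeLociZeroSetOfHolomorphicFrames
import Literature.AlgebraicGeometry.HodgeTheory.HodgeGenericPointsOffSmallCoverFamily
import HarnessLib

/-!
# The non-Hodge-generic points of a projective family of SURFACES lie in a countable union of local
# analytic hypersurfaces (Deligne 1972 Prop. 7.5 / Voisin II Lemma 5.13, zero-set form), from
# holomorphic frames of `F²` alone

Family `hodge`, layer `Literature/AlgebraicGeometry/HodgeTheory`. Theorems only (no definition, no named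
fact). Written by the prover seat `hodge-nonav-prover-Ax` (g13, cell `hodge-nonav`), programme «AE»
(route `HodgeConjecture/CyclicUnitaryPowers`, `--supports stmt-HodgeConjecture-19544`).

`HodgeGenericPointsComeagre` / `HodgeLociDichotomyOfWeightTwoFrames` conclude that the non-Hodge-generic
points (`¬ IsHodgeGenericPoint`) of a smooth projective family form a MEAGRE set. This file keeps track of
the exceptional loci themselves (the general bookkeeping being `HodgeGenericPointsOffSmallCoverFamily`):

* §1 `hodgeLociAlternative_of_weightTwoFrames` — for a projective family of SURFACES with holomorphic
  frames of `F²H²` in charts `ψ` satisfying an arbitrary predicate `Good` (hypothesis `hF2` of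
  `hodgeLociDichotomy_of_weightTwoFrames` with the conjunct `Good ψ`), the alternative holds with
  `Small Z` := «`Z = {t ∈ W | g (ψ t) = 0}` for a path-connected open `W` inside the source of a `Good`
  chart `ψ` and a function `g` holomorphic on `ψ(W)`, non-zero somewhere on it» (zero-set form of the
  dichotomy, `hodgeLoci_subset_zeroSet_of_holomorphicFrame`).
* §2 `exists_countable_analyticCover_not_isHodgeGenericPoint_of_weightTwoFrames` (and its consumer form)
  — hence the non-Hodge-generic points of such a family lie in a countable union of LOCAL ANALYTIC
  HYPERSURFACES read in `Good` charts. Read in algebraic charts (downstream, for the Carlson–Toledo family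
  of cyclic covers) these are Lebesgue-null, so «very general» holds almost everywhere and not only on a
  comeagre set.

Honest scope: reductions; the frames `hF2` are a hypothesis here. Nothing in this file says HC or any
rung is proved; the ALGEBRAIC «very general» (Cattani–Deligne–Kaplan) is not touched.

## References

* [Deligne1972WeilK3] P. Deligne, La conjecture de Weil pour les surfaces K3, Invent. Math. 15 (1972),
  Prop. 7.5.
* [VoisinHodgeII2003] C. Voisin, Hodge Theory and Complex Algebraic Geometry II (2003), §5.3.1
  Lemma 5.13.
* [Andre1992] Y. André, Mumford–Tate groups of mixed Hodge structures …, Compositio Math. 82 (1992), §4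
  Lemma 4.
* [CarlsonMullerStachPeters2017] J. Carlson, S. Müller-Stach, C. Peters, Period Mappings and Period
  Domains, 2nd ed., Def. 15.3.5.
-/

noncomputable section

open CategoryTheory AlgebraicGeometry
open _root_.Topology _root_.Filter
open scoped TensorProduct
open Literature.AlgebraicTopology.SingularHomology
open Literature.AlgebraicGeometry.Motives

namespace Literature.AlgebraicGeometry.HodgeTheory

section HodgeTheory

/-! ### §1 The alternative for a projective family of surfaces from holomorphic frames of `F²` -/

section WeightTwo

variable {𝒳 S : SchemeOver ℂ} (f : 𝒳 ⟶ S)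

/-- **Hodge loci of a projective family of surfaces are cut out by holomorphic equations in the charts
carrying the `F²`-frames** (Voisin II Lemma 5.13, zero-set form; Deligne 1972 Prop. 7.5). Setting and
hypotheses of `hodgeLociDichotomy_of_weightTwoFrames`, except that the chart `ψ` provided by `hF2` is
also required to satisfy an arbitrary predicate `Good` (e.g. «`ψ` is an algebraic chart»). Conclusion:
every point `t₁` has arbitrarily small path-connected open neighbourhoods `W` such that for every
rational tensor `ζ`, every `x ∈ W` and every admissible state `Tx` at `x`, the locus of `t ∈ W` at which
`ζ` is a weight-`0` Hodge tensor along the continuations of `Tx` inside `W` is EITHER all of `W`, OR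
contained in a set `Z = {t ∈ W' | g (ψ t) = 0}` — `W'` a path-connected open inside the source of a
`Good` chart `ψ`, `g` holomorphic on `ψ(W')` and non-zero somewhere on it — which is nowhere dense and
closed in `W` (in fact `W' = W`). Chain: as in `hodgeLociDichotomy_of_weightTwoFrames` (`F¹ = (F²)^⊥`,
`exists_subbundleFrames_of_weightTwo`, `exists_holomorphicFrame_of_subbundleFrames`), ending with
`hodgeLoci_subset_zeroSet_of_holomorphicFrame`. [cite: VoisinHodgeII2003, §5.3.1 Lemma 5.13]
[cite: Deligne1972WeilK3, Prop. 7.5] -/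
theorem hodgeLociAlternative_of_weightTwoFrames [HodgeTensorFacts.{0, 0}] (d : ℕ)
    (hf : IsSmoothProjectiveFamily f 2) (hS : IsQuasiProjectiveOver S)
    [AlgebraicGeometry.SmoothOfRelativeDimension d S.hom]
    (hU : IsCohomologicallyLocallyTrivialOn f (Set.univ : Set (ComplexPoints S)))
    (A : ∀ t : ComplexPoints S, HodgeModel 2 (fiberOver f t)) (hA : ∀ t, (A t).IsHodgeSymmetric)
    [∀ t, Module.Finite ℚ (singularCohomology ℚ ℚ (ComplexPoints (fiberOver f t)) 2)]
    {N₀ : ℕ} (hN₀ : 1 ≤ N₀) (ε : 𝒳 ⟶ projectiveSpace N₀ ℂ)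
    (hε : ∀ t : ComplexPoints S, IsClosedImmersion (fiberι f t ≫ ε).left)
    (Good : OpenPartialHomeomorph (Set.univ : Set (ComplexPoints S)) (Fin d → ℂ) → Prop)
    (hF2 : ∀ (s t₁ : (Set.univ : Set (ComplexPoints S))), ∀ N ∈ 𝓝 t₁,
      ∀ (T₁ : singularCohomology ℚ ℚ (ComplexPoints (fiberOver f s.1)) 2 ≃ₗ[ℚ]
        singularCohomology ℚ ℚ (ComplexPoints (fiberOver f t₁.1)) 2),
      (∃ δ₁ : Path.Homotopic.Quotient s t₁,
        ∀ v, ofRatClass _ 2 (T₁ v) = transportFun f 2 hU δ₁ (ofRatClass _ 2 v)) →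
      ∃ W₀ : Set (Set.univ : Set (ComplexPoints S)), IsOpen W₀ ∧ t₁ ∈ W₀ ∧ W₀ ⊆ N ∧
        IsPathConnected W₀ ∧
      ∃ ψ : OpenPartialHomeomorph (Set.univ : Set (ComplexPoints S)) (Fin d → ℂ), Good ψ ∧ W₀ ⊆ ψ.source ∧
      ∃ (r₂ : ℕ) (w₂ : Fin r₂ → Set.Elem (Set.univ : Set (ComplexPoints S)) →
        ℂ ⊗[ℚ] singularCohomology ℚ ℚ (ComplexPoints (fiberOver f s.1)) 2),
        (∀ t ∈ W₀, ∀ (ε' : Path t₁ t), (∀ r', ε' r' ∈ W₀) →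
          ∀ (T : singularCohomology ℚ ℚ (ComplexPoints (fiberOver f s.1)) 2 ≃ₗ[ℚ]
            singularCohomology ℚ ℚ (ComplexPoints (fiberOver f t.1)) 2),
          (∀ v, ofRatClass _ 2 (T v) = transportFun f 2 hU ⟦ε'⟧ (ofRatClass _ 2 (T₁ v))) →
          LinearIndependent ℂ (fun i ↦ w₂ i t) ∧
            (((A t.1).hodgeStructure (hf.isSmoothProjective t.1) (hA t.1) 2).comapEquiv T).F 2 =
              Submodule.span ℂ (Set.range fun i ↦ w₂ i t)) ∧
        (∀ (i : Fin r₂)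
          (φ : Module.Dual ℂ (ℂ ⊗[ℚ] singularCohomology ℚ ℚ (ComplexPoints (fiberOver f s.1)) 2)),
          AnalyticOnNhd ℂ (fun z ↦ φ (w₂ i (ψ.symm z))) (ψ '' W₀)))
    (s t₁ : (Set.univ : Set (ComplexPoints S))) (N : Set (Set.univ : Set (ComplexPoints S)))
    (hN : N ∈ 𝓝 t₁) :
    ∃ W : Set (Set.univ : Set (ComplexPoints S)), IsOpen W ∧ t₁ ∈ W ∧ W ⊆ N ∧ IsPathConnected W ∧
      ∀ (a b : ℕ) (ζ : hodgeTensorSpace (singularCohomology ℚ ℚ (ComplexPoints (fiberOver f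
        (Subtype.val s))) 2) a b) (x : (Set.univ : Set (ComplexPoints S))),
        x ∈ W → ∀ (Tx : singularCohomology ℚ ℚ (ComplexPoints (fiberOver f (Subtype.val s))) 2 ≃ₗ[ℚ]
          singularCohomology ℚ ℚ (ComplexPoints (fiberOver f (Subtype.val x))) 2),
        (∃ δ : Path.Homotopic.Quotient s x,
          ∀ v, ofRatClass _ 2 (Tx v) = transportFun f 2 hU δ (ofRatClass _ 2 v)) →
        (∀ t ∈ W, ∀ (ε' : Path x t), (∀ r, ε' r ∈ W) → ∀ (T : singularCohomology ℚ ℚ (ComplexPoints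
          (fiberOver f (Subtype.val s))) 2 ≃ₗ[ℚ]
          singularCohomology ℚ ℚ (ComplexPoints (fiberOver f (Subtype.val t))) 2),
          (∀ v, ofRatClass _ 2 (T v) = transportFun f 2 hU ⟦ε'⟧ (ofRatClass _ 2 (Tx v))) →
          ζ ∈ ((((A t.1).hodgeStructure (hf.isSmoothProjective t.1) (hA t.1) 2).comapEquiv T).tensorSpace
            a b).hodgeClasses 0) ∨
        ∃ Z : Set (Set.univ : Set (ComplexPoints S)),
          (∃ (W' : Set (Set.univ : Set (ComplexPoints S)))
            (ψ : OpenPartialHomeomorph (Set.univ : Set (ComplexPoints S)) (Fin d → ℂ)) (g : (Fin d → ℂ) → ℂ),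
            Good ψ ∧ IsOpen W' ∧ IsPathConnected W' ∧ W' ⊆ ψ.source ∧ AnalyticOnNhd ℂ g (ψ '' W') ∧
            (∃ t' ∈ W', g (ψ t') ≠ 0) ∧ Z = {t | t ∈ W' ∧ g (ψ t) = 0}) ∧
          IsNowhereDense Z ∧ (∀ t ∈ W, t ∈ closure Z → t ∈ Z) ∧
        {t : (Set.univ : Set (ComplexPoints S)) | t ∈ W ∧ ∀ (ε' : Path x t),
          (∀ r, ε' r ∈ W) → ∀ (T : singularCohomology ℚ ℚ (ComplexPoints (fiberOver f (Subtype.val s))) 2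
            ≃ₗ[ℚ] singularCohomology ℚ ℚ (ComplexPoints (fiberOver f (Subtype.val t))) 2),
          (∀ v, ofRatClass _ 2 (T v) = transportFun f 2 hU ⟦ε'⟧ (ofRatClass _ 2 (Tx v))) →
          ζ ∈ ((((A t.1).hodgeStructure (hf.isSmoothProjective t.1) (hA t.1) 2).comapEquiv T).tensorSpace
            a b).hodgeClasses 0} ⊆ Z := by
  classical
  -- topology of `S(ℂ)`: a manifold, hence locally path connected
  haveI : AlgebraicGeometry.LocallyOfFiniteType S.hom := hS.locallyOfFiniteType
  haveI : AlgebraicGeometry.IsSeparated S.hom := hS.isVarietyPair_ofScheme.isSeparated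
  haveI : T2Space (ComplexPoints S) := Literature.NumberTheory.Transcendental.t2Space_algPoints_holds _ ℂ
  letI := Motives.ComplexPoints.chartedSpace S d
  haveI : LocallyPathConnectedSpace (ComplexPoints S) :=
    ChartedSpace.locallyPathConnectedSpace (EuclideanSpace ℝ (Fin (2 * d))) _
  haveI : LocallyPathConnectedSpace (Set.univ : Set (ComplexPoints S)) :=
    isOpen_univ.locallyPathConnectedSpace
  have hrat : ∀ (x y : (Set.univ : Set (ComplexPoints S))) (γ : Path.Homotopic.Quotient x y)
      (α : complexBetti (fiberOver f x.1) 2), IsRationalClass α →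
      IsRationalClass (transportFun f 2 hU γ α) :=
    fun x y γ α hα ↦ isRationalClass_transportFun_of_isSmoothProjectiveFamily f 2 d hf hS γ hα
  -- the weight-`2` Hodge structures of the fibres
  set H : ∀ t : (Set.univ : Set (ComplexPoints S)),
      HodgeStructure (singularCohomology ℚ ℚ (ComplexPoints (fiberOver f t.1)) 2) 2 :=
    fun t ↦ (A t.1).hodgeStructure (hf.isSmoothProjective t.1) (hA t.1) 2 with hHdef
  have hF0 : ∀ t : (Set.univ : Set (ComplexPoints S)), (H t).F 0 = ⊤ := fun t ↦ by
    rw [hHdef, HodgeModel.hodgeStructure_F]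
    exact (A t.1).ratF_of_nonpos (hf.isSmoothProjective t.1) 2 le_rfl
  have hF3 : ∀ t : (Set.univ : Set (ComplexPoints S)), (H t).F 3 = ⊥ := fun t ↦ by
    rw [hHdef, HodgeModel.hodgeStructure_F]
    exact (A t.1).ratF_eq_bot (hf.isSmoothProjective t.1) 2 (by norm_num)
  by_cases hjs : Joined s t₁
  · -- an admissible reference state at `t₁`
    obtain ⟨T₁, hT₁⟩ := exists_ratTransport f 2 hU hrat (⟦hjs.somePath⟧ : Path.Homotopic.Quotient s t₁)
    have hT₁' : ∃ δ₁ : Path.Homotopic.Quotient s t₁,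
        ∀ v, ofRatClass _ 2 (T₁ v) = transportFun f 2 hU δ₁ (ofRatClass _ 2 v) := ⟨_, hT₁⟩
    -- the `F²`-frame around `t₁` for this state
    obtain ⟨W₀, hW₀o, ht₁W₀, hW₀N, hW₀pc, ψ, hGood, hW₀ψ, r₂, w₂, hw₂, hw₂hol⟩ := hF2 s t₁ N hN T₁ hT₁'
    -- the fixed polarization form of the base fibre: `hB`, `hB1`
    have hX : ∀ t : (Set.univ : Set (ComplexPoints S)), IsSmoothProjective 2 (fiberOver f t.1) :=
      fun t ↦ hf.isSmoothProjective t.1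
    haveI := hε s.1
    obtain ⟨Ds, cs, hDs⟩ := exists_kaehlerRationalDatum_eq_map (hX s) (fiberι f s.1 ≫ ε)
    have hB := KaehlerRationalDatum.separatingRight_form_baseChange (hX s) Ds (A s.1) (hA s.1) 2
    have hB1 := forall_mem_F_one_comapEquiv_iff_of_closedImmersions f hU hN₀ ε hX (fun t ↦ hε t.1)
      (fun t ↦ A t.1) (fun t ↦ hA t.1) s Ds cs hDs hT₁' W₀
    -- frames of every `F^p` on a smaller `W₁`
    obtain ⟨W₁, hW₁o, ht₁W₁, hW₁W₀, hW₁pc, hfr⟩ := exists_subbundleFrames_of_weightTwo f 2 hU s H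
      hF0 hF3 hW₀o ψ hW₀ψ ht₁W₀ ((Ds.form (hX s) 2).baseChange ℂ) hB hB1 w₂ hw₂ hw₂hol
    choose r w hw hwhol using hfr
    -- graded holomorphic frames for every admissible base state on a smaller `W`, then the dichotomy
    obtain ⟨W, hWo, ht₁W, hWW₁, hWpc, hW⟩ := exists_holomorphicFrame_of_subbundleFrames f 2 hU s hrat
      H hW₁o hW₁pc ψ (hW₁W₀.trans hW₀ψ) ht₁W₁ hT₁' r w hw hwhol
    refine ⟨W, hWo, ht₁W, (hWW₁.trans hW₁W₀).trans hW₀N, hWpc, fun a b ζ x hx Tx hTx ↦ ?_⟩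
    obtain ⟨N', deg, e, hF, hol₁, hol₂⟩ := hW x hx Tx hTx
    have hWψ : W ⊆ ψ.source := (hWW₁.trans hW₁W₀).trans hW₀ψ
    rcases hodgeLoci_subset_zeroSet_of_holomorphicFrame f 2 hU s hrat H hWpc ψ hWψ hx hTx e hF hol₁
      hol₂ a b ζ with hfull | ⟨g, hg, hne, hsub⟩
    · exact Or.inl hfull
    · exact Or.inr ⟨{t | t ∈ W ∧ g (ψ t) = 0}, ⟨W, ψ, g, hGood, hWo, hWpc, hWψ, hg, hne, rfl⟩,
        isNowhereDense_zeroSet_comp_chart hWo hWpc ψ hWψ hg hne,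
        fun t ht htc ↦ mem_zeroSet_comp_chart_of_mem_closure hWo ψ hWψ hg ht htc, hsub⟩
  · -- no admissible state near `t₁`: the condition is void on the path component of `t₁` in `N°`
    have ht₁N : t₁ ∈ interior N := mem_interior_iff_mem_nhds.2 hN
    refine ⟨pathComponentIn (interior N) t₁, isOpen_interior.pathComponentIn t₁,
      mem_pathComponentIn_self ht₁N, pathComponentIn_subset.trans interior_subset,
      isPathConnected_pathComponentIn ht₁N, fun a b ζ x hx Tx hTx ↦ ?_⟩
    exfalso
    obtain ⟨δ, -⟩ := hTx
    induction δ using Quotient.inductionOn with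
    | h γ =>
      exact hjs (Joined.trans ⟨γ⟩
        ((isPathConnected_pathComponentIn ht₁N).joinedIn x hx t₁ (mem_pathComponentIn_self ht₁N)).joined)

end WeightTwo

/-! ### §2 The countable analytic cover of the non-generic points of a family of surfaces -/

section AnalyticCover

variable {𝒳 S : SchemeOver ℂ} (f : 𝒳 ⟶ S)

/-- **The non-Hodge-generic points of a projective family of surfaces lie in a countable union of local
analytic hypersurfaces read in the charts carrying the `F²`-frames** (Deligne 1972 Prop. 7.5 ∕ André 1992
Lemma 4 in the sharper «analytic» form; Voisin II Lemma 5.13): with the hypotheses of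
`hodgeLociAlternative_of_weightTwoFrames` there is a COUNTABLE family `𝒞` of subsets of `S(ℂ)`, each of
the form `{t ∈ W | g (ψ t) = 0}` (`W` path-connected open in the source of a `Good` chart `ψ`, `g`
holomorphic on `ψ(W)` and non-zero somewhere on it) and nowhere dense, such that every non-Hodge-generic
point lies in `⋃₀ 𝒞` (`exists_countable_cover_not_isHodgeGenericPoint_of_lociAlternative` fed with §1).
In particular the non-generic set is meagre (`isMeagre_sUnion_of_countable_isNowhereDense`), as in
`isMeagre_setOf_not_isHodgeGenericPoint_of_weightTwoFrames`. [cite: Deligne1972WeilK3, Prop. 7.5]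
[cite: Andre1992, §4 Lemma 4] [cite: VoisinHodgeII2003, §5.3.1 Lemma 5.13] -/
theorem exists_countable_analyticCover_not_isHodgeGenericPoint_of_weightTwoFrames
    [HodgeTensorFacts.{0, 0}] (d : ℕ)
    (hf : IsSmoothProjectiveFamily f 2) (hS : IsQuasiProjectiveOver S)
    [AlgebraicGeometry.SmoothOfRelativeDimension d S.hom]
    (hU : IsCohomologicallyLocallyTrivialOn f (Set.univ : Set (ComplexPoints S)))
    (A : ∀ t : ComplexPoints S, HodgeModel 2 (fiberOver f t)) (hA : ∀ t, (A t).IsHodgeSymmetric)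
    [∀ t, Module.Finite ℚ (singularCohomology ℚ ℚ (ComplexPoints (fiberOver f t)) 2)]
    {N₀ : ℕ} (hN₀ : 1 ≤ N₀) (ε : 𝒳 ⟶ projectiveSpace N₀ ℂ)
    (hε : ∀ t : ComplexPoints S, IsClosedImmersion (fiberι f t ≫ ε).left)
    (Good : OpenPartialHomeomorph (Set.univ : Set (ComplexPoints S)) (Fin d → ℂ) → Prop)
    (hF2 : ∀ (s t₁ : (Set.univ : Set (ComplexPoints S))), ∀ N ∈ 𝓝 t₁,
      ∀ (T₁ : singularCohomology ℚ ℚ (ComplexPoints (fiberOver f s.1)) 2 ≃ₗ[ℚ]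
        singularCohomology ℚ ℚ (ComplexPoints (fiberOver f t₁.1)) 2),
      (∃ δ₁ : Path.Homotopic.Quotient s t₁,
        ∀ v, ofRatClass _ 2 (T₁ v) = transportFun f 2 hU δ₁ (ofRatClass _ 2 v)) →
      ∃ W₀ : Set (Set.univ : Set (ComplexPoints S)), IsOpen W₀ ∧ t₁ ∈ W₀ ∧ W₀ ⊆ N ∧
        IsPathConnected W₀ ∧
      ∃ ψ : OpenPartialHomeomorph (Set.univ : Set (ComplexPoints S)) (Fin d → ℂ), Good ψ ∧ W₀ ⊆ ψ.source ∧
      ∃ (r₂ : ℕ) (w₂ : Fin r₂ → Set.Elem (Set.univ : Set (ComplexPoints S)) →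
        ℂ ⊗[ℚ] singularCohomology ℚ ℚ (ComplexPoints (fiberOver f s.1)) 2),
        (∀ t ∈ W₀, ∀ (ε' : Path t₁ t), (∀ r', ε' r' ∈ W₀) →
          ∀ (T : singularCohomology ℚ ℚ (ComplexPoints (fiberOver f s.1)) 2 ≃ₗ[ℚ]
            singularCohomology ℚ ℚ (ComplexPoints (fiberOver f t.1)) 2),
          (∀ v, ofRatClass _ 2 (T v) = transportFun f 2 hU ⟦ε'⟧ (ofRatClass _ 2 (T₁ v))) →
          LinearIndependent ℂ (fun i ↦ w₂ i t) ∧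
            (((A t.1).hodgeStructure (hf.isSmoothProjective t.1) (hA t.1) 2).comapEquiv T).F 2 =
              Submodule.span ℂ (Set.range fun i ↦ w₂ i t)) ∧
        (∀ (i : Fin r₂)
          (φ : Module.Dual ℂ (ℂ ⊗[ℚ] singularCohomology ℚ ℚ (ComplexPoints (fiberOver f s.1)) 2)),
          AnalyticOnNhd ℂ (fun z ↦ φ (w₂ i (ψ.symm z))) (ψ '' W₀)))
    :
    ∃ 𝒞 : Set (Set (Set.univ : Set (ComplexPoints S))), 𝒞.Countable ∧
      (∀ Z ∈ 𝒞, (∃ (W' : Set (Set.univ : Set (ComplexPoints S)))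
            (ψ : OpenPartialHomeomorph (Set.univ : Set (ComplexPoints S)) (Fin d → ℂ)) (g : (Fin d → ℂ) → ℂ),
            Good ψ ∧ IsOpen W' ∧ IsPathConnected W' ∧ W' ⊆ ψ.source ∧ AnalyticOnNhd ℂ g (ψ '' W') ∧
            (∃ t' ∈ W', g (ψ t') ≠ 0) ∧ Z = {t | t ∈ W' ∧ g (ψ t) = 0}) ∧ IsNowhereDense Z) ∧
      {t : (Set.univ : Set (ComplexPoints S)) | ¬ IsHodgeGenericPoint f 2 hU hf A hA t} ⊆ ⋃₀ 𝒞 :=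
  exists_countable_cover_not_isHodgeGenericPoint_of_lociAlternative f 2 2 d hf hS hU A hA
    (fun Z ↦ (∃ (W' : Set (Set.univ : Set (ComplexPoints S)))
            (ψ : OpenPartialHomeomorph (Set.univ : Set (ComplexPoints S)) (Fin d → ℂ)) (g : (Fin d → ℂ) → ℂ),
            Good ψ ∧ IsOpen W' ∧ IsPathConnected W' ∧ W' ⊆ ψ.source ∧ AnalyticOnNhd ℂ g (ψ '' W') ∧
            (∃ t' ∈ W', g (ψ t') ≠ 0) ∧ Z = {t | t ∈ W' ∧ g (ψ t) = 0}))
    fun s t₁ N hN ↦ hodgeLociAlternative_of_weightTwoFrames f d hf hS hU A hA hN₀ ε hε Good hF2 s t₁ N hN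

/-- **Consumer form**: a countable family of local analytic hypersurfaces (in `Good` charts) of `S(ℂ)`
off whose union every point is Hodge generic. [cite: Deligne1972WeilK3, Prop. 7.5]
[cite: VoisinHodgeII2003, §5.3.1 Lemma 5.13] -/
theorem exists_countable_analyticCover_isHodgeGenericPoint_of_weightTwoFrames
    [HodgeTensorFacts.{0, 0}] (d : ℕ)
    (hf : IsSmoothProjectiveFamily f 2) (hS : IsQuasiProjectiveOver S)
    [AlgebraicGeometry.SmoothOfRelativeDimension d S.hom]
    (hU : IsCohomologicallyLocallyTrivialOn f (Set.univ : Set (ComplexPoints S)))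
    (A : ∀ t : ComplexPoints S, HodgeModel 2 (fiberOver f t)) (hA : ∀ t, (A t).IsHodgeSymmetric)
    [∀ t, Module.Finite ℚ (singularCohomology ℚ ℚ (ComplexPoints (fiberOver f t)) 2)]
    {N₀ : ℕ} (hN₀ : 1 ≤ N₀) (ε : 𝒳 ⟶ projectiveSpace N₀ ℂ)
    (hε : ∀ t : ComplexPoints S, IsClosedImmersion (fiberι f t ≫ ε).left)
    (Good : OpenPartialHomeomorph (Set.univ : Set (ComplexPoints S)) (Fin d → ℂ) → Prop)
    (hF2 : ∀ (s t₁ : (Set.univ : Set (ComplexPoints S))), ∀ N ∈ 𝓝 t₁,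
      ∀ (T₁ : singularCohomology ℚ ℚ (ComplexPoints (fiberOver f s.1)) 2 ≃ₗ[ℚ]
        singularCohomology ℚ ℚ (ComplexPoints (fiberOver f t₁.1)) 2),
      (∃ δ₁ : Path.Homotopic.Quotient s t₁,
        ∀ v, ofRatClass _ 2 (T₁ v) = transportFun f 2 hU δ₁ (ofRatClass _ 2 v)) →
      ∃ W₀ : Set (Set.univ : Set (ComplexPoints S)), IsOpen W₀ ∧ t₁ ∈ W₀ ∧ W₀ ⊆ N ∧
        IsPathConnected W₀ ∧
      ∃ ψ : OpenPartialHomeomorph (Set.univ : Set (ComplexPoints S)) (Fin d → ℂ), Good ψ ∧ W₀ ⊆ ψ.source ∧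
      ∃ (r₂ : ℕ) (w₂ : Fin r₂ → Set.Elem (Set.univ : Set (ComplexPoints S)) →
        ℂ ⊗[ℚ] singularCohomology ℚ ℚ (ComplexPoints (fiberOver f s.1)) 2),
        (∀ t ∈ W₀, ∀ (ε' : Path t₁ t), (∀ r', ε' r' ∈ W₀) →
          ∀ (T : singularCohomology ℚ ℚ (ComplexPoints (fiberOver f s.1)) 2 ≃ₗ[ℚ]
            singularCohomology ℚ ℚ (ComplexPoints (fiberOver f t.1)) 2),
          (∀ v, ofRatClass _ 2 (T v) = transportFun f 2 hU ⟦ε'⟧ (ofRatClass _ 2 (T₁ v))) →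
          LinearIndependent ℂ (fun i ↦ w₂ i t) ∧
            (((A t.1).hodgeStructure (hf.isSmoothProjective t.1) (hA t.1) 2).comapEquiv T).F 2 =
              Submodule.span ℂ (Set.range fun i ↦ w₂ i t)) ∧
        (∀ (i : Fin r₂)
          (φ : Module.Dual ℂ (ℂ ⊗[ℚ] singularCohomology ℚ ℚ (ComplexPoints (fiberOver f s.1)) 2)),
          AnalyticOnNhd ℂ (fun z ↦ φ (w₂ i (ψ.symm z))) (ψ '' W₀)))
    :
    ∃ 𝒞 : Set (Set (Set.univ : Set (ComplexPoints S))), 𝒞.Countable ∧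
      (∀ Z ∈ 𝒞, (∃ (W' : Set (Set.univ : Set (ComplexPoints S)))
            (ψ : OpenPartialHomeomorph (Set.univ : Set (ComplexPoints S)) (Fin d → ℂ)) (g : (Fin d → ℂ) → ℂ),
            Good ψ ∧ IsOpen W' ∧ IsPathConnected W' ∧ W' ⊆ ψ.source ∧ AnalyticOnNhd ℂ g (ψ '' W') ∧
            (∃ t' ∈ W', g (ψ t') ≠ 0) ∧ Z = {t | t ∈ W' ∧ g (ψ t) = 0}) ∧ IsNowhereDense Z) ∧
      ∀ s : (Set.univ : Set (ComplexPoints S)), s ∉ ⋃₀ 𝒞 → IsHodgeGenericPoint f 2 hU hf A hA s := by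
  obtain ⟨𝒞, h𝒞c, h𝒞s, hcov⟩ :=
    exists_countable_analyticCover_not_isHodgeGenericPoint_of_weightTwoFrames f d hf hS hU A hA hN₀ ε hε
      Good hF2
  refine ⟨𝒞, h𝒞c, h𝒞s, fun s hs ↦ ?_⟩
  by_contra h
  exact hs (hcov h)

end AnalyticCover

end HodgeTheory

end Literature.AlgebraicGeometry.HodgeTheory

end
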